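import Literature.Barriers.ValiantsHypothesis.GCTMatrixPowering
import HarnessLib

/-!
# GCT and matrix powering: Grenet's bound `pc(per_n) ≤ 2^n - 1` in the homogeneous model (proof)

Sibling proof file of `GCTMatrixPowering.lean` (D-0014; the other sibling,
`GCTMatrixPoweringProofs.lean`, assembles Thm. 10 — this file is independent of it). It discharges
the named fact
`Literature.Barriers.ValiantsHypothesis.GIP2017_pc_le`:
"Interestingly, the proof of the best known upper bound `dc(per_m) ≤ 2^m - 1` by Grenet [Gre:11]
also works for this measure: `pc(per_m) ≤ 2^m - 1`" [GesmundoIkenmeyerPanova2017, §2.2], i.e.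
(tree letters) for every `n ≥ 1` the generic permanent `per_n` is `tr(A^n)` for a
`(2^n - 1) × (2^n - 1)` matrix `A` of homogeneous linear forms over `ℂ`.

GIP print no proof; the construction is Grenet's digraph (Grenet 2011; Landsberg 2017,
Prop. 6.6.3.3 and Rem. 6.6.3.4: "This expression is better viewed as an iterated matrix
multiplication ... `perm(y) = (s_{m-1} ⊗ f_m(y)) ⋯ (s_0 ⊗ f_1(y))`"), read for traces of powers
instead of determinants:

* vertices: the subsets `S ⊆ [n]`, with `[n]` identified with `∅` (`2^n - 1` vertices);
* edges `S → S ∪ {j}` for `j ∉ S`, weighted by the variable `X_{j, |S|}` (the new element `j` is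
  the row index, the step number `|S|` the column index — Mathlib's permanent convention
  `per M = Σ_σ ∏_i M (σ i) i`); NO self-loops (those belong to the determinantal version);
* every edge raises `|S|` by one (cyclically), so a closed walk of length `n` passes through `∅`
  exactly once, and closed walks through `∅` are the permutations: `tr(A^n) = n · per_n`.
  Rescaling the edges into `∅ ≡ [n]` by `1/n` (characteristic `0`) gives `tr(A^n) = per_n`.

Lean rendering (namespace `Literature.Barriers.ValiantsHypothesis.Grenet`, all over
`MvPolynomial (Fin n × Fin n) ℂ`): the matrix `adj n` is indexed by ALL of `Finset (Fin n)` with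
`univ` an isolated vertex (zero row), edges `S → wrap (insert j S)` where `wrap univ = ∅`; the
exhibited matrix is its restriction `adjV n` to `{S // S ≠ univ}` (cardinality `2^n - 1`,
`card_V`), transported to `Fin (2^n - 1)`. The count `tr(A^n) = n · (A^n)_{∅∅}` is done by trace
cyclicity on the layers `layer n k = diag [|S| = k]` (`layer_mul_adj`: `P_k A = A P_{k+1}`), and
`(A^n)_{∅∅} = (1/n) per_n` by the dynamic programme `adj_pow_apply_empty` (walks from `S` to `∅`
of length `n - |S|` are the injective enumerations of the complement of `S`).

## References

* [GesmundoIkenmeyerPanova2017] F. Gesmundo, C. Ikenmeyer, G. Panova, *Geometric complexity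
  theory and matrix powering*, Diff. Geom. Appl. 55 (2017) 106–127 = arXiv:1611.00827, §2.2
  (held; `lit read`, p. 6).
* [GrenetPermDet2011] B. Grenet, *An upper bound for the permanent versus determinant problem*
  (2011) — the digraph on subsets of `[n]` (not held; construction checked against Landsberg).
* [LandsbergGCT2017] J. M. Landsberg, *Geometry and Complexity Theory*, CUP 2017, Prop. 6.6.3.3,
  Rem. 6.6.3.4 (held; `lit read`, p. 178).
-/

noncomputable section

namespace Literature.Barriers.ValiantsHypothesis

open Literature.Computability.AlgebraicComplexity MvPolynomial Finset

namespace Grenet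

/-! ### Three generic lemmas (reindexing, splitting a sum over tuples) -/

/-- Powers commute with reindexing along an equivalence. [folklore] -/
theorem submatrix_pow_equiv {l m α : Type*} [Fintype l] [Fintype m] [DecidableEq l]
    [DecidableEq m] [Semiring α] (M : Matrix m m α) (e : l ≃ m) (k : ℕ) :
    (M.submatrix e e) ^ k = (M ^ k).submatrix e e := by
  induction k with
  | zero => rw [pow_zero, pow_zero, Matrix.submatrix_one_equiv]
  | succ k ih => rw [pow_succ, ih, Matrix.submatrix_mul_equiv, ← pow_succ]

/-- The trace is invariant under reindexing along an equivalence. [folklore] -/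
theorem trace_submatrix_equiv {l m α : Type*} [Fintype l] [Fintype m] [AddCommMonoid α]
    (M : Matrix m m α) (e : l ≃ m) : (M.submatrix e e).trace = M.trace := by
  simp only [Matrix.trace, Matrix.diag_apply, Matrix.submatrix_apply]
  exact e.sum_comp (fun i => M i i)

/-- Splitting a sum over `Fin (k+1) → α` along `Fin.cons`. [folklore] -/
theorem sum_pi_fin_succ {M α : Type*} [AddCommMonoid M] [Fintype α] (k : ℕ)
    (G : (Fin (k + 1) → α) → M) :
    ∑ g, G g = ∑ j : α, ∑ f : Fin k → α, G (Fin.cons j f) := by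
  rw [← Fintype.sum_prod_type']
  exact (Fintype.sum_equiv (Fin.consEquiv fun _ => α) _ _ fun _ => rfl).symm

variable (n : ℕ)

/-! ### Grenet's digraph, homogeneous (trace) version -/

/-- The variable `X_{j,k}` for a column index `k` given as a natural number (`0` if `k ≥ n`,
which never happens on the walks that matter). [cite: LandsbergGCT2017, Prop. 6.6.3.3] -/
def xCol (k : ℕ) (j : Fin n) : MvPolynomial (Fin n × Fin n) ℂ :=
  if h : k < n then X (j, ⟨k, h⟩) else 0

/-- The identification `[n] ≡ ∅` of Grenet's digraph: `wrap univ = ∅`, `wrap U = U` otherwise.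
[cite: LandsbergGCT2017, Prop. 6.6.3.3 ("identify S⁰E ≃ (SᵐE)_reg")] -/
def wrap (U : Finset (Fin n)) : Finset (Fin n) :=
  if U = univ then ∅ else U

/-- Edge coefficient: `1/n` on the edges `S → S ∪ {j} = [n] ≡ ∅` closing a walk, `1` otherwise
(the trace counts each closed walk `n` times, once per starting vertex). [folklore] -/
def coef (S : Finset (Fin n)) (j : Fin n) : ℂ :=
  if insert j S = univ then ((n : ℂ))⁻¹ else 1

/-- Grenet's weighted digraph on the subsets of `[n]`, trace version: the entry `(S, T)` is the
weight `coef · X_{j,|S|}` of the edge `S → S ∪ {j}` (`j ∉ S`, target wrapped by `wrap`), and `0`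
if there is no such edge; `univ` itself is an isolated vertex (zero row; for `n ≥ 1` also zero
column), removed in `adjV`. No self-loops.
[cite: LandsbergGCT2017, Prop. 6.6.3.3 and Rem. 6.6.3.4] -/
def adj : Matrix (Finset (Fin n)) (Finset (Fin n)) (MvPolynomial (Fin n × Fin n) ℂ) :=
  Matrix.of fun S T =>
    ∑ j, if j ∉ S ∧ T = wrap n (insert j S) then C (coef n S j) * xCol n S.card j else 0

/-- Unfolding of `adj`. [folklore] -/
theorem adj_apply (S T : Finset (Fin n)) :
    adj n S T = ∑ j, if j ∉ S ∧ T = wrap n (insert j S) then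
      C (coef n S j) * xCol n S.card j else 0 :=
  rfl

/-- `xCol` is a homogeneous linear form. [folklore] -/
theorem xCol_isHomogeneous (k : ℕ) (j : Fin n) : (xCol n k j).IsHomogeneous 1 := by
  unfold xCol
  split_ifs
  · exact isHomogeneous_X _ _
  · exact isHomogeneous_zero _ _ _

/-- For a genuine column index, `xCol` is the variable. [folklore] -/
theorem xCol_fin (i j : Fin n) : xCol n i j = X (j, i) := by
  simp [xCol, i.isLt]

/-- Every entry of Grenet's matrix is a homogeneous linear form. [folklore] -/
theorem adj_isHomogeneous (S T : Finset (Fin n)) : (adj n S T).IsHomogeneous 1 := by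
  rw [adj_apply]
  refine IsHomogeneous.sum _ _ _ fun j _ => ?_
  split_ifs
  · exact (xCol_isHomogeneous n _ _).C_mul _
  · exact isHomogeneous_zero _ _ _

/-- The row of the removed vertex `univ` vanishes. [folklore] -/
theorem adj_univ (T : Finset (Fin n)) : adj n univ T = 0 := by
  simp [adj_apply]

/-- Hence so does the `univ` row of every positive power. [folklore] -/
theorem adj_pow_succ_univ (m : ℕ) (T : Finset (Fin n)) : (adj n ^ (m + 1)) univ T = 0 := by
  rw [pow_succ', Matrix.mul_apply]
  simp [adj_univ]

/-- Support of `adj`: a nonzero entry `(S, T)` is an edge `T = wrap (S ∪ {j})`, `j ∉ S`.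
[folklore] -/
theorem exists_of_adj_ne_zero {S T : Finset (Fin n)} (h : adj n S T ≠ 0) :
    ∃ j, j ∉ S ∧ T = wrap n (insert j S) := by
  by_contra hcon
  apply h
  rw [adj_apply]
  exact Finset.sum_eq_zero fun j _ => if_neg fun hj => hcon ⟨j, hj⟩

/-! ### Layers and the reduction `tr(Aⁿ) = n · (Aⁿ)_{∅∅}` -/

/-- The projection onto the layer `{S : |S| = k}`. [folklore] -/
def layer (k : ℕ) :
    Matrix (Finset (Fin n)) (Finset (Fin n)) (MvPolynomial (Fin n × Fin n) ℂ) :=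
  Matrix.diagonal fun S => if S.card = k then 1 else 0

/-- Partial trace over a layer. [folklore] -/
theorem trace_layer_mul (k : ℕ)
    (M : Matrix (Finset (Fin n)) (Finset (Fin n)) (MvPolynomial (Fin n × Fin n) ℂ)) :
    (layer n k * M).trace = ∑ S, if S.card = k then M S S else 0 := by
  simp [layer, Matrix.trace, ite_mul]

/-- The trace is the sum of the partial traces over the layers `0, …, n`. [folklore] -/
theorem trace_eq_sum_layer
    (M : Matrix (Finset (Fin n)) (Finset (Fin n)) (MvPolynomial (Fin n × Fin n) ℂ)) :
    M.trace = ∑ k ∈ range (n + 1), (layer n k * M).trace := by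
  simp only [trace_layer_mul]
  rw [Finset.sum_comm]
  simp only [Finset.sum_ite_eq, Finset.mem_range, Matrix.trace, Matrix.diag_apply]
  refine Finset.sum_congr rfl fun S _ => ?_
  rw [if_pos (Nat.lt_succ_of_le (by simpa using S.card_le_univ))]

/-- The partial trace over layer `0` is the `(∅, ∅)` entry. [folklore] -/
theorem trace_layer_zero_mul
    (M : Matrix (Finset (Fin n)) (Finset (Fin n)) (MvPolynomial (Fin n × Fin n) ℂ)) :
    (layer n 0 * M).trace = M ∅ ∅ := by
  simp [trace_layer_mul, Finset.card_eq_zero]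

/-- The partial trace of a positive power over the top layer `{univ}` vanishes. [folklore] -/
theorem trace_layer_top_mul_pow (m : ℕ) : (layer n n * adj n ^ (m + 1)).trace = 0 := by
  rw [trace_layer_mul]
  refine Finset.sum_eq_zero fun S _ => ?_
  split_ifs with h
  · rw [(Finset.card_eq_iff_eq_univ S).mp (by simpa using h)]
    exact adj_pow_succ_univ n m _
  · rfl

/-- Edges go from layer `k` to layer `k + 1` (`k + 1 < n`): `P_k A = A P_{k+1}`. [folklore] -/
theorem layer_mul_adj (k : ℕ) (hk : k + 1 < n) : layer n k * adj n = adj n * layer n (k + 1) := by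
  ext S T
  simp only [layer, Matrix.diagonal_mul, Matrix.mul_diagonal, ite_mul, one_mul, zero_mul, mul_ite,
    mul_one, mul_zero]
  by_cases h : adj n S T = 0
  · simp [h]
  · obtain ⟨j, hj, rfl⟩ := exists_of_adj_ne_zero n h
    have key : S.card = k ↔ (wrap n (insert j S)).card = k + 1 := by
      unfold wrap
      split_ifs with hu
      · have := congrArg Finset.card hu
        rw [Finset.card_insert_of_notMem hj, Finset.card_univ, Fintype.card_fin] at this
        simp only [Finset.card_empty]
        omega
      · rw [Finset.card_insert_of_notMem hj]
        omega
    simp only [key]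

/-- Trace cyclicity moves the partial trace one layer up. [folklore] -/
theorem trace_layer_succ (k m : ℕ) (hk : k + 1 < n) :
    (layer n k * adj n ^ (m + 1)).trace = (layer n (k + 1) * adj n ^ (m + 1)).trace := by
  calc (layer n k * adj n ^ (m + 1)).trace
      = ((layer n k * adj n) * adj n ^ m).trace := by rw [pow_succ', mul_assoc]
    _ = ((layer n (k + 1) * adj n ^ m) * adj n).trace := by
        rw [layer_mul_adj n k hk, mul_assoc, Matrix.trace_mul_comm]
    _ = (layer n (k + 1) * adj n ^ (m + 1)).trace := by rw [mul_assoc, ← pow_succ]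

/-- All partial traces over the layers `k < n` agree with the one over layer `0`. [folklore] -/
theorem trace_layer_eq_layer_zero (m : ℕ) :
    ∀ k, k < n → (layer n k * adj n ^ (m + 1)).trace = (layer n 0 * adj n ^ (m + 1)).trace
  | 0, _ => rfl
  | k + 1, hk => by
    rw [← trace_layer_succ n k m hk]
    exact trace_layer_eq_layer_zero m k (by omega)

/-- `tr(Aⁿ) = n · (Aⁿ)_{∅∅}`: each closed walk is counted once per starting layer. [folklore] -/
theorem trace_adj_pow (hn : 1 ≤ n) : (adj n ^ n).trace = n • (adj n ^ n) ∅ ∅ := by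
  obtain ⟨m, rfl⟩ : ∃ m, n = m + 1 := ⟨n - 1, by omega⟩
  rw [trace_eq_sum_layer, Finset.sum_range_succ, trace_layer_top_mul_pow, add_zero,
    Finset.sum_congr rfl fun k hk =>
      trace_layer_eq_layer_zero (m + 1) m k (Finset.mem_range.mp hk),
    Finset.sum_const, Finset.card_range, trace_layer_zero_mul]

/-! ### Walks into `∅`: the dynamic programme -/

/-- Walks of length `k ≥ 1` from `S` (`|S| + k = n`) to `∅ ≡ [n]` are the injective enumerations
`f` of elements outside `S`, with weight `(1/n) ∏_i X_{f i, |S| + i}`. [folklore] -/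
theorem adj_pow_apply_empty : ∀ k : ℕ, 1 ≤ k → ∀ S : Finset (Fin n), S.card + k = n →
    (adj n ^ k) S ∅ = C ((n : ℂ)⁻¹) * ∑ f : Fin k → Fin n,
      (if Function.Injective f ∧ ∀ i, f i ∉ S then
        ∏ i : Fin k, xCol n (S.card + (i : ℕ)) (f i) else 0) := by
  intro k
  induction k with
  | zero => intro h; exact absurd h (by norm_num)
  | succ k ih =>
    intro _ S hS
    rcases Nat.eq_zero_or_pos k with rfl | hk
    · -- walks of length one: the closing edges `S → [n] ≡ ∅`
      have huniv : ∀ j, j ∉ S → insert j S = univ := fun j hj =>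
        Finset.eq_univ_of_card _ (by rw [Finset.card_insert_of_notMem hj, Fintype.card_fin]; omega)
      rw [pow_succ, pow_zero, one_mul, adj_apply, sum_pi_fin_succ, Finset.mul_sum]
      refine Finset.sum_congr rfl fun j _ => ?_
      simp only [Fintype.sum_unique, Fin.prod_univ_succ, Fin.prod_univ_zero, mul_one, Fin.cons_zero,
        Fin.forall_fin_succ, IsEmpty.forall_iff, and_true, Fin.val_zero, add_zero,
        Fin.cons_injective_iff, Set.range_eq_empty, Set.mem_empty_iff_false, not_false_eq_true,
        Function.injective_of_subsingleton, true_and]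
      by_cases hj : j ∈ S
      · simp [hj]
      · simp [hj, wrap, coef, huniv j hj]
    · -- walks of length `k + 1 ≥ 2`: first edge `S → S ∪ {j}`, then a walk from `S ∪ {j}`
      rw [pow_succ', Matrix.mul_apply]
      simp only [adj_apply n S, Finset.sum_mul, ite_mul, zero_mul]
      rw [Finset.sum_comm, sum_pi_fin_succ, Finset.mul_sum]
      refine Finset.sum_congr rfl fun j _ => ?_
      by_cases hj : j ∈ S
      · simp [hj, Fin.forall_fin_succ]
      · have hcard : (insert j S).card = S.card + 1 := Finset.card_insert_of_notMem hj
        have hne : insert j S ≠ univ := fun hu => by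
          have := congrArg Finset.card hu
          rw [hcard, Finset.card_univ, Fintype.card_fin] at this
          omega
        have hwrap : wrap n (insert j S) = insert j S := if_neg hne
        have hcoef : coef n S j = 1 := if_neg hne
        simp only [hj, not_false_eq_true, true_and, hwrap, hcoef, map_one, one_mul,
          Finset.sum_ite_eq', Finset.mem_univ, if_true]
        rw [ih hk (insert j S) (by rw [hcard]; omega), mul_left_comm]
        congr 1
        rw [Finset.mul_sum]
        refine Finset.sum_congr rfl fun f _ => ?_
        have e3 : ∀ i : Fin k, S.card + 1 + (i : ℕ) = S.card + ((i : ℕ) + 1) := fun i => by omega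
        simp only [hcard, Fin.prod_univ_succ, Fin.cons_zero, Fin.cons_succ, Fin.val_zero, add_zero,
          Fin.val_succ, Fin.cons_injective_iff, Fin.forall_fin_succ, Set.mem_range, not_exists,
          Finset.mem_insert, not_or, mul_ite, mul_zero, hj, not_false_eq_true, true_and, e3,
          forall_and]
        split_ifs with h₁ h₂ h₂
        · rfl
        · exfalso; tauto
        · exfalso; tauto
        · rfl

/-- The injective self-maps of `Fin n` are the permutations: the closed-walk sum at `∅` is the
generic permanent. [folklore] -/
theorem sum_injective_eq_perPoly :
    (∑ f : Fin n → Fin n,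
      if Function.Injective f then ∏ i, (X (f i, i) : MvPolynomial (Fin n × Fin n) ℂ) else 0) =
      perPoly (Fin n) ℂ := by
  have himg : (univ : Finset (Equiv.Perm (Fin n))).image
      (fun σ : Equiv.Perm (Fin n) => (σ : Fin n → Fin n)) = univ.filter Function.Injective := by
    ext f
    simp only [Finset.mem_image, Finset.mem_univ, true_and, Finset.mem_filter]
    constructor
    · rintro ⟨σ, rfl⟩
      exact σ.injective
    · intro hf
      exact ⟨Equiv.ofBijective f (Finite.injective_iff_bijective.mp hf), rfl⟩
  rw [← Finset.sum_filter, ← himg, Finset.sum_image fun σ _ τ _ h => DFunLike.coe_injective h]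
  simp [perPoly, Matrix.permanent]

/-- `(Aⁿ)_{∅∅} = (1/n) · per_n`. [folklore] -/
theorem adj_pow_empty_empty (hn : 1 ≤ n) :
    (adj n ^ n) ∅ ∅ = C ((n : ℂ)⁻¹) * perPoly (Fin n) ℂ := by
  rw [adj_pow_apply_empty n n hn ∅ (by simp), ← sum_injective_eq_perPoly]
  congr 1
  refine Finset.sum_congr rfl fun f _ => ?_
  simp [xCol_fin]

/-! ### Removing the isolated vertex `univ` and transporting to `Fin (2^n - 1)` -/

/-- The vertex set of Grenet's digraph: subsets of `[n]` other than `[n]` itself (which is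
identified with `∅`). [cite: LandsbergGCT2017, Prop. 6.6.3.3] -/
abbrev V : Type := {S : Finset (Fin n) // S ≠ univ}

/-- Grenet's digraph has `2^n - 1` vertices.
[cite: LandsbergGCT2017, Prop. 6.6.3.3 ("so n = 2^m - 1")] -/
theorem card_V : Fintype.card (V n) = 2 ^ n - 1 := by
  rw [Fintype.card_subtype, Finset.filter_ne', Finset.card_erase_of_mem (Finset.mem_univ _),
    Finset.card_univ, Fintype.card_finset, Fintype.card_fin]

/-- Grenet's matrix proper: `adj` restricted to the `2^n - 1` genuine vertices.
[cite: LandsbergGCT2017, Prop. 6.6.3.3 and Rem. 6.6.3.4] -/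
def adjV : Matrix (V n) (V n) (MvPolynomial (Fin n × Fin n) ℂ) :=
  (adj n).submatrix Subtype.val Subtype.val

/-- Splitting a sum over all subsets into the genuine vertices and `univ`. [folklore] -/
theorem sum_V (g : Finset (Fin n) → MvPolynomial (Fin n × Fin n) ℂ) :
    ∑ U, g U = (∑ U : V n, g U.1) + g univ := by
  rw [← Finset.sum_erase_add _ _ (Finset.mem_univ (univ : Finset (Fin n))),
    Finset.sum_subtype (univ.erase univ) (p := fun S => S ≠ univ) (by simp)]

/-- Powers of the restriction are restrictions of the powers (`univ` has zero row). [folklore] -/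
theorem adjV_pow (k : ℕ) : adjV n ^ k = (adj n ^ k).submatrix Subtype.val Subtype.val := by
  induction k with
  | zero => rw [pow_zero, pow_zero, Matrix.submatrix_one _ Subtype.val_injective]
  | succ k ih =>
    rw [pow_succ, ih, pow_succ]
    ext S T
    rw [Matrix.mul_apply, Matrix.submatrix_apply, Matrix.mul_apply, sum_V]
    simp [adjV, adj_univ]

/-- The restriction does not change the trace of the `n`-th power. [folklore] -/
theorem trace_adjV_pow (hn : 1 ≤ n) : (adjV n ^ n).trace = (adj n ^ n).trace := by
  obtain ⟨m, rfl⟩ : ∃ m, n = m + 1 := ⟨n - 1, by omega⟩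
  rw [adjV_pow]
  simp only [Matrix.trace, Matrix.diag_apply, Matrix.submatrix_apply]
  rw [sum_V (m + 1) fun U => (adj (m + 1) ^ (m + 1)) U U, adj_pow_succ_univ, add_zero]

end Grenet

open Grenet in
/-- **Grenet's bound in the homogeneous model, `pc(per_n) ≤ 2^n - 1`** (discharge of
`GIP2017_pc_le`): for `n ≥ 1`, `per_n = tr(Aⁿ)` for the `(2^n - 1) × (2^n - 1)` matrix `A` of
homogeneous linear forms given by Grenet's digraph on the proper subsets of `[n]` (edges
`S → S ∪ {j}` weighted `X_{j,|S|}`, the closing edges into `[n] ≡ ∅` rescaled by `1/n`).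
"the proof of the best known upper bound `dc(per_m) ≤ 2^m-1` by Grenet also works for this
measure: `pc(per_m) ≤ 2^m-1`". [cite: GesmundoIkenmeyerPanova2017, §2.2 (definition of pc)] -/
theorem GIP2017_pc_le_holds : GIP2017_pc_le := by
  intro n hn
  let e : Fin (2 ^ n - 1) ≃ V n := (Fintype.equivFinOfCardEq (card_V n)).symm
  refine ⟨(adjV n).submatrix e e, fun i j => adj_isHomogeneous n _ _, ?_⟩
  rw [submatrix_pow_equiv, trace_submatrix_equiv, trace_adjV_pow n hn, trace_adj_pow n hn,
    adj_pow_empty_empty n hn, nsmul_eq_mul, ← mul_assoc,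
    ← map_natCast (C : ℂ →+* MvPolynomial (Fin n × Fin n) ℂ) n, ← map_mul,
    mul_inv_cancel₀ (by exact_mod_cast (show n ≠ 0 by omega)), map_one, one_mul]

/-- Corollary: `pc(per_n) ≤ 2^n - 1` for `n ≥ 1`, with `pc` the tree's `powTraceComplexity`
(an `sInf`, bounded by the witness of `GIP2017_pc_le_holds`).
[cite: GesmundoIkenmeyerPanova2017, §2.2 ("pc(per_m) ≤ 2^m - 1")] -/
theorem powTraceComplexity_perPoly_le {n : ℕ} (hn : 1 ≤ n) :
    powTraceComplexity ℂ (perPoly (Fin n) ℂ) n ≤ 2 ^ n - 1 :=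
  Nat.sInf_le (GIP2017_pc_le_holds n hn)

end Literature.Barriers.ValiantsHypothesis
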